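/-
Copyright (c) 2026. Released under Apache 2.0 license as described in the file LICENSE.
-/
import Literature.NumberTheory.LFunctions.ZetaCertifiedEvaluation
import Literature.NumberTheory.LFunctions.Xiao2020.ZetaOneTaylorEM
import Literature.NumberTheory.LFunctions.Xiao2020.ZetaNatEM
import Literature.NumberTheory.LFunctions.Xiao2020.CertEnclosure
import HarnessLib

/-!
# Xiao (2020), Conj. 3.4 — soundness of the interval certificate, II: tables and `ζ(k)`

Continuation of `Xiao2020.CertEnclosure`: the index bookkeeping of the natural-number rows of
`Xiao2020.CertKernel` (`pochRow` = the numbers `pochCoeff`, Pascal rows, the second-difference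
weights `erow`, `dSeq`, the final sign scan `checkD`), the real form `emMainOneCoeffR` of the
Euler–Maclaurin coefficients `Xiao2020.emMainOneCoeff` together with its reorganisation by powers
(the form the program computes), and the enclosure `CertKernel.mem_zetaBox` of `ζ(k)`, `k ≥ 2`,
from `Xiao2020.abs_re_riemannZeta_nat_sub_zetaNatMain_le`.  Reference for the target statement:
[Xiao2020, Conj. 3.4].
-/

namespace Literature.NumberTheory.LFunctions.Xiao2020

open Literature.Analysis.ValidatedNumerics Literature.Analysis.ValidatedNumerics.NumericsMP Finset
open scoped Nat

namespace CertKernel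

variable {S : ℕ}

/-! ### Rows of naturals / integers read off by index -/

/-- [folklore] -/
lemma getD_zipWith_lt {α β γ : Type*} (f : α → β → γ) {L : List α} {M : List β} {i : ℕ}
    (hL : i < L.length) (hM : i < M.length) (d : γ) (da : α) (db : β) :
    (List.zipWith f L M).getD i d = f (L.getD i da) (M.getD i db) := by
  rw [List.getD_eq_getElem?_getD, List.getElem?_zipWith, List.getElem?_eq_getElem hL,
    List.getElem?_eq_getElem hM]
  simp [List.getD_eq_getElem?_getD, List.getElem?_eq_getElem hL, List.getElem?_eq_getElem hM]

/-- [folklore] -/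
lemma getD_of_le {α : Type*} {L : List α} {i : ℕ} (h : L.length ≤ i) (d : α) : L.getD i d = d := by
  rw [List.getD_eq_getElem?_getD, List.getElem?_eq_none_iff.2 h]; rfl

/-- [folklore] -/
@[simp] lemma length_pochRow : ∀ m, (pochRow m).length = m + 1
  | 0 => rfl
  | m + 1 => by simp [pochRow, length_pochRow m]

/-- `pc(m, l) = 0` for `l > m`. [folklore] -/
lemma pochCoeff_eq_zero_of_lt : ∀ {m l : ℕ}, m < l → pochCoeff m l = 0
  | 0, l + 1, _ => by simp [pochCoeff]
  | m + 1, l + 1, h => by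
    rw [pochCoeff, pochCoeff_eq_zero_of_lt (by omega : m < l + 1), pochCoeff_eq_zero_of_lt (by omega)]
    simp

/-- [folklore] -/
lemma pochRow_getD : ∀ (m l : ℕ), (pochRow m).getD l 0 = pochCoeff m l
  | 0, 0 => by simp [pochRow, pochCoeff]
  | 0, l + 1 => by simp [pochRow, pochCoeff]
  | m + 1, l => by
    have ih := pochRow_getD m
    by_cases hl : l ≤ m + 1
    · rw [pochRow, getD_zipWith_lt _ (by simp; omega) (by simp; omega) 0 0 0]
      rcases Nat.eq_zero_or_pos l with rfl | hl0
      · rw [List.getD_cons_zero, List.getD_eq_getElem?_getD, List.getElem?_append_left (by simp),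
          ← List.getD_eq_getElem?_getD, ih, pochCoeff]; ring
      · obtain ⟨l, rfl⟩ : ∃ l', l = l' + 1 := ⟨l - 1, by omega⟩
        rw [List.getD_cons_succ, ih, pochCoeff]
        rcases Nat.lt_or_ge (l + 1) (m + 1) with h | h
        · rw [List.getD_eq_getElem?_getD, List.getElem?_append_left (by simpa using h),
            ← List.getD_eq_getElem?_getD, ih]
        · have hl1 : l + 1 = m + 1 := by omega
          rw [List.getD_eq_getElem?_getD, List.getElem?_append_right (by simp; omega)]
          simp [hl1, pochCoeff_eq_zero_of_lt (show m < m + 1 by omega)]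
    · push Not at hl
      rw [getD_of_le (by simp; omega), pochCoeff_eq_zero_of_lt hl]

/-- [folklore] -/
lemma pochRows_getD {ν j : ℕ} (hj : j < ν) (l : ℕ) :
    ((pochRows ν).getD j []).getD l 0 = pochCoeff (2 * (j + 1) - 1) l := by
  have : (pochRows ν).getD j [] = pochRow (2 * (j + 1) - 1) := by
    rw [pochRows, List.getD_eq_getElem?_getD, List.getElem?_map, List.getElem?_range hj]
    simp
  rw [this, pochRow_getD]

/-- `R` is the zero-padded row `k ↦ g k` of length `len`. [folklore] -/
def RowIs (g : ℕ → ℕ) (len : ℕ) (R : List ℕ) : Prop := R.length = len ∧ ∀ k < len, R.getD k 0 = g k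

/-- [folklore] -/
lemma rowIs_pascalNext {n len : ℕ} {R : List ℕ} (h : RowIs n.choose len R) :
    RowIs (n + 1).choose len (pascalNext R) := by
  refine ⟨by simp [pascalNext, h.1], fun k hk ↦ ?_⟩
  rw [pascalNext, getD_zipWith_lt _ (by rw [h.1]; exact hk) (by simp [h.1]; omega) 0 0 0, h.2 k hk]
  cases k with
  | zero => simp
  | succ k => rw [List.getD_cons_succ, h.2 k (by omega), Nat.choose_succ_succ', add_comm]

/-- [folklore] -/
lemma rowIs_row0 (len : ℕ) : RowIs (Nat.choose 0) (len + 1) (1 :: List.replicate len 0) := by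
  refine ⟨by simp, fun k hk ↦ ?_⟩
  cases k with
  | zero => simp
  | succ k =>
    rw [List.getD_cons_succ, List.getD_eq_getElem?_getD, List.getElem?_replicate]
    simp [show k < len by omega]

/-- The second-difference weights. [folklore] -/
def eW (n k : ℕ) : ℤ := (k : ℤ) * ((n.choose k : ℤ) - 2 * ((n - 1).choose k : ℤ) + ((n - 2).choose k : ℤ))

/-- [folklore] -/
lemma erow_spec {n len : ℕ} {R2 R1 R0 : List ℕ} (h2 : RowIs n.choose len R2)
    (h1 : RowIs (n - 1).choose len R1) (h0 : RowIs (n - 2).choose len R0) :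
    (erow len R2 R1 R0).length = len ∧ ∀ k < len, (erow len R2 R1 R0).getD k 0 = eW n k := by
  have hl2 := h2.1; have hl1 := h1.1; have hl0 := h0.1
  refine ⟨by simp [erow, hl2, hl1, hl0], fun k hk ↦ ?_⟩
  rw [erow, getD_zipWith_lt _ (by simpa using hk) (by simp [hl2, hl1, hl0, hk]) 0 0 0,
    getD_zipWith_lt _ (by simp [hl2, hl1, hk]) (by simp [hl0, hk]) 0 0 0,
    getD_zipWith_lt _ (by simp [hl2, hk]) (by simp [hl1, hk]) 0 0 0,
    h2.2 k hk, h1.2 k hk, h0.2 k hk, List.getD_eq_getElem?_getD, List.getElem?_range hk]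
  simp [eW]

/-- [folklore] -/
@[simp] lemma length_dSeq (len : ℕ) (A : List MI) : ∀ (R0 R1 R2 : List ℕ) (c : ℕ),
    (dSeq len A R0 R1 R2 c).length = c
  | _, _, _, 0 => rfl
  | R0, R1, R2, c + 1 => by simp [dSeq, length_dSeq]

/-- [folklore] -/
lemma encl_dSeq {len : ℕ} {A : List MI} {a : ℕ → ℝ} (hA : Encl S a A) (hAl : A.length = len) :
    ∀ (c n : ℕ) (R0 R1 R2 : List ℕ), 2 ≤ n → RowIs (n - 2).choose len R0 →
      RowIs (n - 1).choose len R1 → RowIs n.choose len R2 →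
      Encl S (fun j ↦ ∑ k ∈ Finset.range len, (eW (n + j) k : ℝ) * a k) (dSeq len A R0 R1 R2 c)
  | 0, _, _, _, _, _, _, _, _ => trivial
  | c + 1, n, R0, R1, R2, hn, h0, h1, h2 => by
    simp only [dSeq]
    refine ⟨?_, ?_⟩
    · obtain ⟨hel, he⟩ := erow_spec h2 h1 h0
      have := mem_dotZ (erow len R2 R1 R0) hA
      rw [hel, hAl, min_self] at this
      have hsum : ∑ k ∈ Finset.range len, ((erow len R2 R1 R0).getD k 0 : ℝ) * a k =
          ∑ k ∈ Finset.range len, (eW n k : ℝ) * a k :=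
        Finset.sum_congr rfl fun k hk ↦ by rw [he k (Finset.mem_range.1 hk)]
      rw [hsum] at this
      simpa using this
    · have := encl_dSeq hA hAl c (n + 1) R1 R2 (pascalNext R2) (by omega)
        (by simpa using h1) (by simpa using h2) (rowIs_pascalNext h2)
      exact this.congr' fun j ↦ by simp [add_assoc, add_comm 1 j]

/-- [folklore] -/
lemma checkD_spec (nNeg : ℕ) : ∀ (L : List MI) (n : ℕ), checkD nNeg L n = true → n ≤ nNeg →
    (∀ i, n + i < nNeg → 0 < (L.getD i zeroI).lo) ∧ (L.getD (nNeg - n) zeroI).hi < 0 ∧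
      nNeg - n < L.length
  | [], _, h, _ => by simp [checkD] at h
  | D :: L, n, h, hn => by
    simp only [checkD] at h
    split_ifs at h with hlt
    · simp only [Bool.and_eq_true, decide_eq_true_eq] at h
      obtain ⟨hih, hneg, hlen⟩ := checkD_spec nNeg L (n + 1) h.2 hlt
      refine ⟨fun i hi ↦ ?_, ?_, ?_⟩
      · cases i with
        | zero => simpa using h.1
        | succ i => simpa using hih i (by omega)
      · obtain ⟨d, hd⟩ : ∃ d, nNeg - n = d + 1 := ⟨nNeg - n - 1, by omega⟩
        rw [hd, List.getD_cons_succ, show d = nNeg - (n + 1) by omega]; exact hneg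
      · simp; omega
    · have hn' : n = nNeg := by omega
      subst hn'
      simp only [decide_eq_true_eq] at h
      exact ⟨fun i hi ↦ by omega, by simpa using h, by simp⟩

/-! ### The real form of the Euler–Maclaurin coefficients `[wⁱ]P_{N,ν}` -/

/-- Real version of `expMonCoeff`: `[wⁱ](wˡe^{cw}) = c^{i−l}/(i−l)!`. [folklore] -/
noncomputable def expMonCoeffR (l : ℕ) (c : ℝ) (i : ℕ) : ℝ :=
  if l ≤ i then c ^ (i - l) / (i - l)! else 0

/-- [folklore] -/
lemma expMonCoeff_ofReal (l : ℕ) (c : ℝ) (i : ℕ) :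
    expMonCoeff l (c : ℂ) i = (expMonCoeffR l c i : ℂ) := by
  unfold expMonCoeff expMonCoeffR
  split_ifs <;> push_cast <;> rfl

/-- [folklore] -/
lemma aTerm_eq (n i : ℕ) : aTerm n i = (n : ℝ)⁻¹ * expMonCoeffR 1 (-Real.log n) i := by
  unfold aTerm expMonCoeffR
  split_ifs <;> ring

/-- `g_l = Σ_{k=1}^{ν} (B_{2k}/(2k)!) N^{−2k} pc(2k−1, l)`. [folklore] -/
noncomputable def gCoeffR (N ν l : ℕ) : ℝ :=
  ∑ k ∈ Finset.Icc 1 ν,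
    (bernoulli (2 * k) : ℝ) / (2 * k)! * ((N : ℝ) ^ (2 * k))⁻¹ * (pochCoeff (2 * k - 1) l : ℝ)

/-- The real form of `[wⁱ]P_{N,ν}` (same shape as `emMainOneCoeff`). [folklore] -/
noncomputable def emMainOneCoeffR (N ν i : ℕ) : ℝ :=
  (∑ n ∈ Finset.Ico 1 N, (n : ℝ)⁻¹ * expMonCoeffR 1 (-Real.log n) i) +
  expMonCoeffR 0 (-Real.log N) i +
  (2 * N : ℝ)⁻¹ * expMonCoeffR 1 (-Real.log N) i +
  ∑ p ∈ (Finset.Icc 1 ν).sigma (fun k ↦ Finset.range (2 * k)),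
    ((bernoulli (2 * p.1) : ℝ) / (2 * p.1)! * ((N : ℝ) ^ (2 * p.1))⁻¹ *
      (pochCoeff (2 * p.1 - 1) p.2 : ℝ)) * expMonCoeffR (p.2 + 1) (-Real.log N) i

/-- [folklore] -/
theorem emMainOneCoeff_eq_ofReal (N ν i : ℕ) :
    emMainOneCoeff N ν i = (emMainOneCoeffR N ν i : ℂ) := by
  simp only [emMainOneCoeff, emMainOneCoeffR, ← Complex.ofReal_natCast, ← Complex.ofReal_neg,
    expMonCoeff_ofReal]
  push_cast
  ring

/-- [folklore] -/
theorem emMainOneCoeff_re (N ν i : ℕ) : (emMainOneCoeff N ν i).re = emMainOneCoeffR N ν i := by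
  rw [emMainOneCoeff_eq_ofReal, Complex.ofReal_re]

/-- The reorganised form computed by the program: the Bernoulli double sum collected by the
power of `w`. [folklore] -/
theorem emMainOneCoeffR_eq (N ν i : ℕ) : emMainOneCoeffR N ν i =
    (∑ n ∈ Finset.Ico 1 N, aTerm n i) + (-Real.log N) ^ i / i ! +
    (2 * N : ℝ)⁻¹ * expMonCoeffR 1 (-Real.log N) i +
    ∑ l ∈ Finset.range (2 * ν), gCoeffR N ν l * expMonCoeffR (l + 1) (-Real.log N) i := by
  unfold emMainOneCoeffR
  have h1 : ∑ n ∈ Finset.Ico 1 N, (n : ℝ)⁻¹ * expMonCoeffR 1 (-Real.log n) i =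
      ∑ n ∈ Finset.Ico 1 N, aTerm n i := Finset.sum_congr rfl fun n _ ↦ (aTerm_eq n i).symm
  have h2 : expMonCoeffR 0 (-Real.log N) i = (-Real.log N) ^ i / i ! := by simp [expMonCoeffR]
  have h4 : ∑ p ∈ (Finset.Icc 1 ν).sigma (fun k ↦ Finset.range (2 * k)),
      ((bernoulli (2 * p.1) : ℝ) / (2 * p.1)! * ((N : ℝ) ^ (2 * p.1))⁻¹ *
        (pochCoeff (2 * p.1 - 1) p.2 : ℝ)) * expMonCoeffR (p.2 + 1) (-Real.log N) i =
      ∑ l ∈ Finset.range (2 * ν), gCoeffR N ν l * expMonCoeffR (l + 1) (-Real.log N) i := by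
    rw [Finset.sum_sigma]
    have : ∀ k ∈ Finset.Icc 1 ν, ∑ l ∈ Finset.range (2 * k),
        ((bernoulli (2 * k) : ℝ) / (2 * k)! * ((N : ℝ) ^ (2 * k))⁻¹ * (pochCoeff (2 * k - 1) l : ℝ)) *
          expMonCoeffR (l + 1) (-Real.log N) i =
        ∑ l ∈ Finset.range (2 * ν),
        ((bernoulli (2 * k) : ℝ) / (2 * k)! * ((N : ℝ) ^ (2 * k))⁻¹ * (pochCoeff (2 * k - 1) l : ℝ)) *
          expMonCoeffR (l + 1) (-Real.log N) i := by
      intro k hk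
      rw [Finset.mem_Icc] at hk
      refine Finset.sum_subset (Finset.range_subset_range.2 (by omega)) fun l _ hl ↦ ?_
      rw [Finset.mem_range, not_lt] at hl
      rw [pochCoeff_eq_zero_of_lt (by omega)]
      simp
    rw [Finset.sum_congr rfl this, Finset.sum_comm]
    refine Finset.sum_congr rfl fun l _ ↦ ?_
    rw [gCoeffR, Finset.sum_mul]
  rw [h1, h2, h4]

/-! ### `zetaBox`: `ζ(k)` for integers `k ≥ 2` -/

/-- [folklore] -/
lemma mem_invPowSum (S k : ℕ) : ∀ M : ℕ,
    MI.mem S (∑ m ∈ Finset.range M, 1 / ((m + 1 : ℕ) : ℝ) ^ k) (invPowSum S k M)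
  | 0 => by simpa [invPowSum] using mem_zeroI S
  | M + 1 => by
    rw [invPowSum, Finset.sum_range_succ]
    refine MI.mem_add (mem_invPowSum S k M) ?_
    have := mem_fracBox S 1 (q := (M + 1) ^ k) (by positivity)
    simpa using this

/-- [folklore] -/
lemma mem_bernPass (S : ℕ) {Nn : ℕ} (hN : 0 < Nn) (k : ℕ) (d : ℕ → ℚ) :
    ∀ (ds : List ℚ) (j : ℕ) (acc : MI) (x : ℝ),
    (∀ i < ds.length, ds.getD i 0 = d (j + i)) → MI.mem S x acc →
    MI.mem S (x + ∑ i ∈ Finset.Ico j (j + ds.length), (d i : ℝ) *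
        ((∏ i' ∈ Finset.range (2 * i + 1), (k + i') : ℕ) : ℝ) / (Nn : ℝ) ^ (k + 2 * i + 1))
      (bernPass S Nn k ds j (∏ i' ∈ Finset.range (2 * j + 1), (k + i')) (Nn ^ (k + 2 * j + 1)) acc)
  | [], j, acc, x, _, hacc => by simpa [bernPass] using hacc
  | c :: cs, j, acc, x, hds, hacc => by
    rw [bernPass]
    have hc : c = d j := by simpa using hds 0 (by simp)
    have hterm : MI.mem S ((d j : ℝ) * ((∏ i' ∈ Finset.range (2 * j + 1), (k + i') : ℕ) : ℝ) /
        (Nn : ℝ) ^ (k + 2 * j + 1))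
        (zfracBox S (c.num * (∏ i' ∈ Finset.range (2 * j + 1), (k + i') : ℕ))
          (c.den * Nn ^ (k + 2 * j + 1))) := by
      have := mem_zfracBox S (c.num * (∏ i' ∈ Finset.range (2 * j + 1), (k + i') : ℕ))
        (q := c.den * Nn ^ (k + 2 * j + 1)) (Nat.mul_pos c.den_pos (pow_pos hN _))
      convert this using 1
      rw [← hc, Rat.cast_def c]
      push_cast
      rw [div_mul_eq_mul_div, div_div]
    have hpk : (∏ i' ∈ Finset.range (2 * j + 1), (k + i')) * ((k + 2 * j + 1) * (k + 2 * j + 2)) =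
        ∏ i' ∈ Finset.range (2 * (j + 1) + 1), (k + i') := by
      rw [show 2 * (j + 1) + 1 = 2 * j + 1 + 1 + 1 by ring]
      conv_rhs => rw [Finset.prod_range_succ, Finset.prod_range_succ]
      ring
    have hpw : Nn ^ (k + 2 * j + 1) * Nn ^ 2 = Nn ^ (k + 2 * (j + 1) + 1) := by
      rw [← pow_add]; ring_nf
    have := mem_bernPass S hN k d cs (j + 1) _ _ (fun i hi ↦ by
      simpa [Nat.add_assoc, Nat.add_comm 1 i] using hds (i + 1) (by simpa using hi))
      (MI.mem_add hacc hterm)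
    rw [hpk, hpw]
    convert this using 1
    rw [List.length_cons, show j + (cs.length + 1) = j + 1 + cs.length by omega,
      Finset.sum_eq_sum_Ico_succ_bot (show j < j + 1 + cs.length by omega)]
    ring


/-- [folklore] -/
lemma mem_bernTermSum (S : ℕ) {Nn : ℕ} (hN : 0 < Nn) (k : ℕ) {cs : List ℚ} {ν : ℕ}
    (hcs : ∀ j < ν, cs.getD (j + 1) 0 = ZetaNumerics.emCoeff (j + 1)) (hlen : ν + 1 ≤ cs.length) :
    MI.mem S (∑ i ∈ Finset.range ν, (ZetaNumerics.emCoeff (i + 1) : ℝ) *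
        ((∏ i' ∈ Finset.range (2 * i + 1), (k + i') : ℕ) : ℝ) / (Nn : ℝ) ^ (k + 2 * i + 1))
      (bernTermSum S cs Nn ν k) := by
  have hl : ((cs.drop 1).take ν).length = ν := by
    rw [List.length_take, List.length_drop]; omega
  have := mem_bernPass S hN k (fun i ↦ ZetaNumerics.emCoeff (i + 1)) ((cs.drop 1).take ν) 0 zeroI 0
    (fun i hi ↦ by
      rw [hl] at hi
      show ((cs.drop 1).take ν).getD i 0 = ZetaNumerics.emCoeff (0 + i + 1)
      rw [Nat.zero_add, List.getD_eq_getElem?_getD, List.getElem?_take, if_pos hi,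
        List.getElem?_drop, ← List.getD_eq_getElem?_getD, Nat.add_comm 1 i, hcs i hi])
    (mem_zeroI S)
  rw [hl, zero_add, zero_add, ← Finset.range_eq_Ico] at this
  simpa [bernTermSum] using this

/-- [folklore] -/
lemma zetaNatMain_cast (Nn ν k : ℕ) : ((zetaNatMain Nn ν k : ℚ) : ℝ) =
    (∑ m ∈ Finset.range (Nn - 1), 1 / ((m + 1 : ℕ) : ℝ) ^ k) +
    (((Nn : ℚ) / ((Nn : ℚ) ^ k * ((k : ℚ) - 1)) : ℚ) : ℝ) + (((1 / (2 * (Nn : ℚ) ^ k)) : ℚ) : ℝ) +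
    ∑ i ∈ Finset.range ν, (ZetaNumerics.emCoeff (i + 1) : ℝ) *
        ((∏ i' ∈ Finset.range (2 * i + 1), (k + i') : ℕ) : ℝ) / (Nn : ℝ) ^ (k + 2 * i + 1) := by
  simp only [zetaNatMain, ZetaNumerics.emCoeff, show ∀ i : ℕ, 2 * (i + 1) - 1 = 2 * i + 1 from
    fun i ↦ by omega, show ∀ i : ℕ, k + (2 * i + 1) = k + 2 * i + 1 from fun i ↦ by omega]
  push_cast
  ring

/-- `zetaBox` encloses `ζ(k)` (`k ≥ 2`). [folklore] -/
theorem mem_zetaBox (S : ℕ) {Nn ν k : ℕ} (hN : 1 ≤ Nn) (hν : ν ≠ 0) (hk : 2 ≤ k) {cs : List ℚ}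
    (hcs : ∀ j < ν, cs.getD (j + 1) 0 = ZetaNumerics.emCoeff (j + 1)) (hlen : ν + 1 ≤ cs.length) :
    MI.mem S (riemannZeta (k : ℂ)).re (zetaBox S cs Nn ν k) := by
  have hmain := MI.mem_add (MI.mem_add (MI.mem_add (mem_invPowSum S k (Nn - 1))
    (mem_ratBox S ((Nn : ℚ) / ((Nn : ℚ) ^ k * ((k : ℚ) - 1)))))
    (mem_ratBox S (1 / (2 * (Nn : ℚ) ^ k)))) (mem_bernTermSum S (Nn := Nn) (show 0 < Nn by omega) k hcs hlen)
  rw [← zetaNatMain_cast] at hmain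
  refine MI.mem_widen hmain ?_
  have hS0 : (0 : ℝ) ≤ S := by positivity
  refine (mul_le_mul_of_nonneg_right (abs_re_riemannZeta_nat_sub_zetaNatMain_le hN hν hk) hS0).trans
    ?_
  exact le_ceilScaled S _

end CertKernel

end Literature.NumberTheory.LFunctions.Xiao2020
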